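import Summits.ResolutionOfSingularities.ResolutionOfSingularities.Theorems.EquisingularLiftEquisingularLiftNatReducedExceptionalPlaneLocal
import Summits.ResolutionOfSingularities.ResolutionOfSingularities.Theorems.EquisingularLiftEquisingularLiftNatDirStepUnobsHostChange
import Literature.AlgebraicGeometry.Resolution.ExceptionalDivisorProjectiveBundleAffine
import Literature.AlgebraicGeometry.Resolution.AffineBlowupIntegral
import HarnessLib

/-!
# [OURS · L1 W4.5(b) · EL♮(3) · NEST host kit, part 2] THE FRESH PLANE IS A PROJECTIVE PLANE:
# `redSub G' (υ⁻¹{x}) ≅ ℙⁿ_R` (`R` a field) for ANY blow-up `υ` of a closed point `x` with `𝒪_{G,x}` regular of dimension `n + 1`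

Crux chain w45b (cell `res-hironaka`, LADDER-RESOLUTION rung L, slot W4.5(b)), child EL♮(3) = stmt-ResolutionOfSingularities-20148;
WIDTH TABLE D3 «NEST» (desk RULING R39; D3-10 «the host door», ✓ p655267 `…NatDirStepUnobsHostChange`).  The NEST round (post-carrier
`TowerNestB₅` ✓ `…NatTowerNestDefs`, or the parked in-carrier variant of R41′) blows up a curve `Z` inside the FRESH PLANE `E' = υ⁻¹{y}` of a
point step and carries the residue-side clause `DirStepUnobs G' E' _ Z _`; the desk's D3-10 booking named the one generic input still missing
for door (ii) (model certificate ⇒ NEST clause): the isomorphism «fresh plane ≅ ℙ²».  This file proves it from the point-step hypotheses ALONE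
(`𝒪_{G,y}` regular — no regularity of the stage away from `y`).  res-L1-w45b-iso-w2 g2 (WIDTH seat D-0157 DOOR 1), `--supports
stmt-ResolutionOfSingularities-20148 --as helper`.  OURS; NOT a statement of any manuscript; AI-written, weaker than expert review.
No `sorry`; standard axioms; DEF-FREE.

WHAT (namespace `…Cruxes.EquisingularLiftNat.Sections`).
* `exists_isQuasiRegular_away_of_isRegularLocalRing_atMaximal_card` — the ring step WITH THE COUNT: `A` Noetherian, `𝔭` maximal, `A_𝔭` regular
  local of dimension `d` ⇒ `g ∉ 𝔭` and EXACTLY `d` elements `f₁, …, f_d ∈ 𝔭` with `𝔭·A[1/g] = (f)` quasi-regular in `A[1/g]` (the tree's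
  `exists_isQuasiRegular_away_of_isRegularLocalRing_atPrime`, …NatReducedExceptionalPlaneLocal — adapted — with the length pinned by
  `dim_κ 𝔪/𝔪² = d = spanFinrank 𝔪`: Matsumura 14.2 through the Literature's `exists_span_eq_of_isRegularLocalRing_quotient`).
* `isField_quotient_map_of_isMaximal_away` — `A[1/g] ⧸ 𝔭·A[1/g]` is a field for `𝔭` maximal, `g ∉ 𝔭`.
* **`exists_iso_proj_redSub_preimage_singleton`** — `G` locally Noetherian, `x` closed with `𝒪_{G,x}` regular of dimension `n + 1`,
  `υ : G' ⟶ G` ANY blow-up of `𝓘{x}`: there are a FIELD `R` (as `R : CommRingCat` with `IsField R`; it is `Γ` of the reduced point, `≅ κ(x)`)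
  and an isomorphism `Proj R[T₀, …, Tₙ] ≅ redSub G' (υ⁻¹{x})`.  Proof: the count lemma on an affine `D(g) ∋ x`, restriction of the blow-up
  (`IsBlowup.restrict`), the Literature's affine form of Hartshorne II 8.24 (b) ✓ `exists_iso_pullback_proj_of_isQuasiRegular`
  (ExceptionalDivisorProjectiveBundleAffine) for the scheme-theoretic fibre `E_V = (υ|_V) ×_V V(𝓘{x}|_V)`, and the identification of `E_V` — a REDUCED
  (it is `ℙⁿ` over a field: Literature `Proj.isReduced`) closed subscheme of `G'` with support `υ⁻¹{x}` — with `redSub G' (υ⁻¹{x})` by uniqueness of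
  the reduced structure (Literature `exists_iso_of_isClosedImmersion_of_range_eq`).
* **`dirStepUnobs_freshPlane_of_forall_model`** — DOOR (ii) END TO END: for closed `Z ⊆ υ⁻¹{x}`, a MODEL statement «for every field `R` and every
  `e : ℙⁿ_R ≅ redSub G' (υ⁻¹{x})`, `DirStepUnobs ℙⁿ_R univ _ (e⁻¹ Z) _`» gives the NEST clause `DirStepUnobs G' (υ⁻¹{x}) _ Z hZ` (plane iso + (H2)
  ✓ `dirStepUnobs_of_model_iso`).

Degenerate instances (by type): `n = 0` — `𝒪_{G,x}` a DVR-like regular ring of dimension 1, the fresh plane is one reduced point `≅ ℙ⁰_R = Spec R`,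
consistent; `Z = ∅` in the corollary — both sides inhabited.  `hdim` is load-bearing (it fixes the `n` of `ℙⁿ`); `hreg` is what makes the
exceptional fibre a projective space at all (for a non-regular point it is the projectivised tangent CONE).  HONEST SCOPE: no cohomology is computed
here — the model statements (D3-8-type certificates, or a generic «curves in `ℙ²` are unobstructed») are separate objects; counted 0; EL♮(3) is NOT
proved; resolution in characteristic `p` is NOT proved here (dim 3 is Cossart–Piltant 2008/2009 in print).

References (index only): R. Hartshorne, *Algebraic Geometry* (1977), II Thm. 8.24 (b) [cite: Hartshorne1977]; Q. Liu, *Algebraic Geometry and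
Arithmetic Curves* (2002), Thm. 8.1.19 (b) [cite: Liu2002]; H. Matsumura, *Commutative Ring Theory* (1986), Thms. 14.2, 16.2 [cite: Matsumura1987].
-/

set_option linter.dupNamespace false -- mandated namespace `Summit.<Summit>.<Problem>` of this single-conjunct summit

noncomputable section

open CategoryTheory CategoryTheory.Limits AlgebraicGeometry TopologicalSpace IsLocalRing
open Literature.AlgebraicGeometry.Resolution
open AlgebraicGeometry.Scheme.IdealSheafData

namespace Summit.ResolutionOfSingularities.ResolutionOfSingularities.Cruxes.EquisingularLiftNat.Sections

universe u

/-! ### The ring step at a MAXIMAL ideal, with the number of generators pinned to the dimension -/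

/-- **Local structure of a closed regular point, with the count.**  `A` Noetherian, `𝔭` maximal with `A_𝔭` a regular local ring of dimension
`d`.  Then there are `g ∉ 𝔭` and `f₁, …, f_d ∈ 𝔭` — EXACTLY `d = dim A_𝔭` of them — such that in `A[1/g]`: `𝔭·A[1/g] = (f)` and `f` is
quasi-regular.  (The tree's `exists_isQuasiRegular_away_of_isRegularLocalRing_atPrime`, …NatReducedExceptionalPlaneLocal, with the length of the
sequence pinned: the generators chosen by `exists_span_eq_of_isRegularLocalRing_quotient` have linearly independent differentials in `𝔪/𝔪²`,
so their number is `≤ dim_κ 𝔪/𝔪² = d`, and `≥ d` because they generate `𝔪`.) [cite: Liu2002, Thm. 8.1.19] [cite: Matsumura1987, Thm. 14.2] -/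
theorem exists_isQuasiRegular_away_of_isRegularLocalRing_atMaximal_card {A : Type u} [CommRing A] [IsNoetherianRing A]
    (p : Ideal A) [hp : p.IsMaximal] [IsRegularLocalRing (Localization.AtPrime p)] {d : ℕ}
    (hdim : ringKrullDim (Localization.AtPrime p) = d) :
    ∃ g : A, g ∉ p ∧ ∃ f : Fin d → A, (∀ i, f i ∈ p) ∧
      ∀ (L : Type u) [CommRing L] [Algebra A L] [IsLocalization.Away g L],
        Ideal.map (algebraMap A L) p = Ideal.span (Set.range (algebraMap A L ∘ f)) ∧
        IsQuasiRegular (algebraMap A L ∘ f) := by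
  -- adapted from …NatReducedExceptionalPlaneLocal (`exists_isQuasiRegular_away_of_isRegularLocalRing_atPrime`), itself adapted from
  -- Literature/AlgebraicGeometry/Resolution/RegularCentreLocal.lean
  classical
  set S := Localization.AtPrime p with hS
  have hJm : p.map (algebraMap A S) ≤ maximalIdeal S := by
    rw [← Localization.AtPrime.map_eq_maximalIdeal]
  haveI : IsRegularRing (A ⧸ p) := quotient_isMaximal_isRegularRing p
  haveI := isRegularLocalRing_localization_quotient_of_le p p le_rfl
  have hG : Ideal.span (algebraMap A S '' (p : Set A)) = p.map (algebraMap A S) := rfl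
  obtain ⟨c, f', hf'G, hspan', hli⟩ := exists_span_eq_of_isRegularLocalRing_quotient hJm _ hG
  have hf'm : ∀ i, f' i ∈ maximalIdeal S := fun i => hJm (hspan' ▸ Ideal.subset_span ⟨i, rfl⟩)
  -- THE COUNT: `c = d`
  have hcd : c = d := by
    apply le_antisymm
    · -- `c ≤ dim_κ 𝔪/𝔪² = d`
      have h1 : Fintype.card (Fin c) ≤ Module.finrank (ResidueField S) (CotangentSpace S) := hli.fintype_card_le_finrank
      have h2 : (Module.finrank (ResidueField S) (CotangentSpace S) : WithBot ℕ∞) = ringKrullDim S :=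
        (IsRegularLocalRing.iff_finrank_cotangentSpace S).mp inferInstance
      rw [hdim] at h2
      have h3 : Module.finrank (ResidueField S) (CotangentSpace S) = d := by exact_mod_cast h2
      simpa [h3] using h1
    · -- `d = dim S ≤ #generators of 𝔪`
      have h1 : ringKrullDim S ≤ (maximalIdeal S).spanFinrank := ringKrullDim_le_spanFinrank_maximalIdeal S
      have hmS : maximalIdeal S = Ideal.span (Set.range f') := by
        rw [hspan', ← Localization.AtPrime.map_eq_maximalIdeal]
      have h2 : (maximalIdeal S).spanFinrank ≤ c := by
        rw [hmS]
        refine (Submodule.spanFinrank_span_le_ncard_of_finite (Set.finite_range f')).trans ?_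
        rw [← Set.image_univ]
        refine (Set.ncard_image_le Set.finite_univ).trans ?_
        rw [Set.ncard_univ, Nat.card_eq_fintype_card, Fintype.card_fin]
      rw [hdim] at h1
      have h3 : (d : WithBot ℕ∞) ≤ ((maximalIdeal S).spanFinrank : ℕ) := h1
      have h4 : d ≤ (maximalIdeal S).spanFinrank := by exact_mod_cast h3
      exact h4.trans h2
  subst hcd
  -- quasi-regularity and the colon conditions over `S` (Matsumura 14.2 / 16.2)
  have hcolon' : ∀ (i : Fin c) (T : Set (Fin c)), i ∉ T → ∀ y : S, f' i * y ∈ Ideal.span (f' '' T) → y ∈ Ideal.span (f' '' T) :=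
    fun i T hiT y hy => mem_span_image_of_mul_mem_of_linearIndependent_toCotangent f' hf'm hli i T hiT y hy
  -- preimages `f_i ∈ p`
  have hpre : ∀ i, ∃ a : A, a ∈ p ∧ algebraMap A S a = f' i := fun i => by
    obtain ⟨a, ha, h⟩ := hf'G i
    exact ⟨a, ha, h⟩
  choose f hfI hff' using hpre
  have hrange : Set.range f' = Set.range (algebraMap A S ∘ f) := by
    ext z
    simp only [Set.mem_range, Function.comp_apply, hff']
  have himg : ∀ i : Fin c, Ideal.span (f' '' Set.Iio i) = (Ideal.span (f '' Set.Iio i)).map (algebraMap A S) := fun i => by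
    rw [Ideal.map_span, Set.image_image]
    congr 1
    ext z
    simp only [Set.mem_image, hff']
  -- `f` is an `A_p`-sequence, in colon form over `A`
  have hreg : ∀ (i : Fin c) (y : A), f i * y ∈ Ideal.span (f '' Set.Iio i) → ∃ s : A, s ∉ p ∧ s * y ∈ Ideal.span (f '' Set.Iio i) := by
    intro i y hy
    have h1 : f' i * algebraMap A S y ∈ Ideal.span (f' '' Set.Iio i) := by
      rw [himg, ← hff', ← map_mul]
      exact Ideal.mem_map_of_mem _ hy
    have h2 := hcolon' i (Set.Iio i) (fun h => lt_irrefl i h) _ h1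
    rw [himg, IsLocalization.algebraMap_mem_map_algebraMap_iff p.primeCompl] at h2
    obtain ⟨s, hs, hsy⟩ := h2
    exact ⟨s, hs, hsy⟩
  obtain ⟨g₁, hg₁p, hg₁⟩ := exists_uniform_multiplier_of_regular_at_prime f p hreg
  -- the generators of `p` lie in `(f) A_p`: clear denominators
  obtain ⟨gens, hgens⟩ := (IsNoetherian.noetherian p : p.FG)
  have hgen1 : ∀ x : A, x ∈ gens → ∃ t : A, t ∉ p ∧ t * x ∈ Ideal.span (Set.range f) := by
    intro x hx
    have hxI : x ∈ p := hgens ▸ Submodule.subset_span hx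
    have h1 : algebraMap A S x ∈ Ideal.span (Set.range f') := by
      rw [hspan']
      exact Ideal.mem_map_of_mem _ hxI
    rw [hrange, Set.range_comp, ← Ideal.map_span, IsLocalization.algebraMap_mem_map_algebraMap_iff p.primeCompl] at h1
    obtain ⟨t, ht, htx⟩ := h1
    exact ⟨t, ht, htx⟩
  choose! t ht using hgen1
  have hg₀p : (∏ x ∈ gens, t x) ∉ p := by
    intro hmem
    obtain ⟨x, hx, htx⟩ := (hp.isPrime.prod_mem_iff).mp hmem
    exact (ht x hx).1 htx
  refine ⟨(∏ x ∈ gens, t x) * g₁, fun h => (hp.isPrime.mem_or_mem h).elim hg₀p hg₁p, f, hfI, ?_⟩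
  intro L _ _ _
  have hunit : ∀ x : A, x ∈ gens → IsUnit (algebraMap A L (t x)) := by
    intro x hx
    have hu : IsUnit (algebraMap A L ((∏ x ∈ gens, t x) * g₁)) := IsLocalization.Away.algebraMap_isUnit _
    obtain ⟨r, hr⟩ : t x ∣ (∏ x ∈ gens, t x) * g₁ := (Finset.dvd_prod_of_mem t hx).mul_right g₁
    rw [hr, map_mul] at hu
    exact isUnit_of_mul_isUnit_left hu
  -- (a) `p A[1/g] = (f)`
  have hIL : p.map (algebraMap A L) = Ideal.span (Set.range (algebraMap A L ∘ f)) := by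
    apply le_antisymm
    · rw [← hgens, Ideal.map_span, Ideal.span_le]
      rintro _ ⟨x, hx, rfl⟩
      have hx' : x ∈ gens := hx
      have hmem : algebraMap A L (t x * x) ∈ Ideal.span (Set.range (algebraMap A L ∘ f)) := by
        rw [Set.range_comp, ← Ideal.map_span]
        exact Ideal.mem_map_of_mem _ (ht x hx').2
      rw [map_mul] at hmem
      exact (Ideal.unit_mul_mem_iff_mem _ (hunit x hx')).mp hmem
    · rw [Ideal.span_le]
      rintro _ ⟨i, rfl⟩
      exact Ideal.mem_map_of_mem _ (hfI i)
  -- (b) quasi-regular in `A[1/g]`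
  have hg : ∀ (i : Fin c) (y : A), f i * y ∈ Ideal.span (f '' Set.Iio i) → (∏ x ∈ gens, t x) * g₁ * y ∈ Ideal.span (f '' Set.Iio i) :=
    fun i y hy => by
    rw [mul_assoc]
    exact Ideal.mul_mem_left _ _ (hg₁ i y hy)
  have hqr : IsQuasiRegular (algebraMap A L ∘ f) :=
    isQuasiRegular_of_regularSeq c _ fun i z hz => regularSeq_map_of_uniform_multiplier f hg L i z hz
  exact ⟨hIL, hqr⟩


/-! ### Localising a maximal ideal away from an element outside it keeps the quotient a field -/

/-- For `𝔭` maximal and `g ∉ 𝔭`, the quotient `A[1/g] ⧸ 𝔭·A[1/g]` is a field (it is `A ⧸ 𝔭`). [folklore] -/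
theorem isField_quotient_map_of_isMaximal_away {A : Type u} [CommRing A] (p : Ideal A) [hp : p.IsMaximal] {g : A} (hg : g ∉ p)
    (L : Type u) [CommRing L] [Algebra A L] [IsLocalization.Away g L] :
    IsField (L ⧸ p.map (algebraMap A L)) := by
  have hdisj : Disjoint (Submonoid.powers g : Set A) (p : Set A) := (Ideal.disjoint_powers_iff_notMem_of_isPrime g).mpr hg
  haveI hprime : (p.map (algebraMap A L)).IsPrime := IsLocalization.isPrime_of_isPrime_disjoint (Submonoid.powers g) L p hp.isPrime hdisj
  have hunder : (p.map (algebraMap A L)).under A = p := IsLocalization.under_map_of_isPrime_disjoint (Submonoid.powers g) L hp.isPrime hdisj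
  have H : p ≤ (p.map (algebraMap A L)).comap (algebraMap A L) := Ideal.le_comap_map
  have hmax : ((p.map (algebraMap A L)).under A).IsMaximal := by rw [hunder]; exact hp
  have hsurj : Function.Surjective (Ideal.quotientMap (p.map (algebraMap A L)) (algebraMap A L) H) :=
    IsLocalization.surjective_quotientMap_of_maximal_of_localization (Submonoid.powers g) L (H := H) hmax
  have hcomap : (p.map (algebraMap A L)).comap (algebraMap A L) ≤ p := le_of_eq hunder
  have hinj : Function.Injective (Ideal.quotientMap (p.map (algebraMap A L)) (algebraMap A L) H) :=
    Ideal.quotientMap_injective' hcomap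
  letI : Field (A ⧸ p) := Ideal.Quotient.field p
  exact MulEquiv.isField (Field.toIsField (A ⧸ p))
    (RingEquiv.ofBijective (Ideal.quotientMap (p.map (algebraMap A L)) (algebraMap A L) H) ⟨hinj, hsurj⟩).symm.toMulEquiv

/-! ### The fresh plane is a projective space -/

/-- **THE FRESH PLANE IS A PROJECTIVE SPACE** (Hartshorne II Thm. 8.24 (b) / Liu Thm. 8.1.19 (b), at ONE regular closed point).  `G` locally
Noetherian, `x ∈ G` a closed point whose local ring `𝒪_{G,x}` is regular of dimension `n + 1` (nothing is assumed about `G` away from `x` — the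
hypothesis of the `TowerNestB₅` / in-carrier point steps), `υ : G' ⟶ G` ANY blow-up of the reduced point `𝓘{x}`.  Then the REDUCED exceptional plane
`redSub G' (υ⁻¹{x})` (the fresh plane `E' = υ⁻¹{y}` of the NEST round, host of its `DirStepUnobs` clause) is isomorphic to the projective space
`ℙⁿ_R = Proj R[T₀, …, Tₙ]` over a FIELD `R` (the global sections of the reduced point, `≅ κ(x)`).  With `n = 2` and the model door (H2)
✓ `dirStepUnobs_of_model_iso` (…NatDirStepUnobsHostChange), a NEST unobstructedness certificate is a model certificate on `ℙ²_R` plus the name of the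
model curve.  PROOF: an affine `D(g) ∋ x` on which `𝓘{x}` is cut out by a quasi-regular sequence of length EXACTLY `n + 1`
(`exists_isQuasiRegular_away_of_isRegularLocalRing_atMaximal_card`), the blow-up restricted over it, the Literature's affine form
✓ `exists_iso_pullback_proj_of_isQuasiRegular` (ExceptionalDivisorProjectiveBundleAffine) for the scheme-theoretic fibre, and the identification of
that fibre — a reduced closed subscheme of `G'` (reduced because `ℙⁿ_R` is) with support `υ⁻¹{x}` — with `redSub G' (υ⁻¹{x})` (uniqueness of the
reduced induced structure, ✓ `exists_iso_of_isClosedImmersion_of_range_eq`). [cite: Hartshorne1977, II Thm. 8.24 (b)] [cite: Liu2002, Thm. 8.1.19 (b)]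
[OURS assembly · L1 W4.5b · EL♮(3) · NEST host kit; NOT a statement of the manuscript] -/
theorem exists_iso_proj_redSub_preimage_singleton {G G' : Scheme.{0}} [IsLocallyNoetherian G]
    {x : G} (hx : IsClosed ({x} : Set G)) (hreg : IsRegularLocalRing (G.presheaf.stalk x))
    {n : ℕ} (hdim : ringKrullDim (G.presheaf.stalk x) = (n + 1 : ℕ))
    {υ : G' ⟶ G} (hυ : IsBlowup υ (vanishingIdeal ⟨{x}, hx⟩)) :
    ∃ (R : CommRingCat.{0}) (_ : IsField R),
      Nonempty ((letI := MvPolynomial.gradedAlgebra (σ := Fin (n + 1)) (R := (R : Type));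
        Proj (Literature.AlgebraicGeometry.Motives.Segre.grading (Fin (n + 1)) R)) ≅
        redSub G' (υ ⁻¹' {x}) (hx.preimage υ.continuous)) := by
  classical
  letI gradedInst : ∀ (S : Type) [CommRing S], GradedAlgebra (Literature.AlgebraicGeometry.Motives.Segre.grading (Fin (n + 1)) S) :=
    fun S _ => MvPolynomial.gradedAlgebra
  set J : G.IdealSheafData := vanishingIdeal ⟨{x}, hx⟩ with hJ
  -- an affine open `W ∋ x`; the prime `𝔭` of `x` is maximal and `Γ(W)_𝔭 ≅ 𝒪_{G,x}` is regular of dimension `n + 1`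
  obtain ⟨W, hW, hxW, -⟩ := exists_isAffineOpen_mem_and_subset (X := G) (x := x) (U := ⊤) (Opens.mem_top _)
  -- work with the point as an element `y : W` (the section → stalk algebra instance is keyed on it)
  obtain ⟨y, rfl⟩ : ∃ y : W, (y : G) = x := ⟨⟨x, hxW⟩, rfl⟩
  haveI : IsNoetherianRing Γ(G, W) := IsLocallyNoetherian.component_noetherian ⟨W, hW⟩
  set 𝔭 := hW.primeIdealOf y with h𝔭
  haveI h𝔭max : 𝔭.asIdeal.IsMaximal := by
    have hcl := hx.preimage hW.fromSpec.continuous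
    rw [fromSpec_preimage_singleton hW y.2] at hcl
    exact (PrimeSpectrum.isClosed_singleton_iff_isMaximal _).mp hcl
  haveI := hW.isLocalization_stalk y
  haveI : IsRegularLocalRing (G.presheaf.stalk (y : G)) := hreg
  let eSt : G.presheaf.stalk (y : G) ≃+* Localization.AtPrime 𝔭.asIdeal :=
    (IsLocalization.algEquiv 𝔭.asIdeal.primeCompl (G.presheaf.stalk (y : G)) (Localization.AtPrime 𝔭.asIdeal)).toRingEquiv
  haveI h𝔭reg : IsRegularLocalRing (Localization.AtPrime 𝔭.asIdeal) := IsRegularLocalRing.of_ringEquiv eSt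
  have hdim' : ringKrullDim (Localization.AtPrime 𝔭.asIdeal) = (n + 1 : ℕ) := by
    rw [← ringKrullDim_eq_of_ringEquiv eSt]; exact hdim
  set I : Ideal Γ(G, W) := J.ideal ⟨W, hW⟩ with hI
  have hI𝔭 : I = 𝔭.asIdeal := by rw [hI, hJ, h𝔭]; exact vanishingIdeal_singleton_ideal hW hx y.2
  -- membership in basic opens
  have hmemD : ∀ g : Γ(G, W), (y : G) ∈ G.basicOpen g ↔ g ∉ 𝔭.asIdeal := by
    intro g
    rw [← PrimeSpectrum.mem_basicOpen, ← hW.fromSpec_preimage_basicOpen g]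
    change _ ↔ hW.fromSpec 𝔭 ∈ G.basicOpen g
    rw [h𝔭, hW.fromSpec_primeIdealOf y]
  -- the local structure theorem at the maximal ideal `𝔭`, with exactly `n + 1` quasi-regular generators on `D(g) ∋ x`
  obtain ⟨g, hgp, f, -, hloc⟩ := exists_isQuasiRegular_away_of_isRegularLocalRing_atMaximal_card 𝔭.asIdeal hdim'
  have hxg : (y : G) ∈ G.basicOpen g := (hmemD g).mpr hgp
  set V : G.Opens := G.basicOpen g with hV
  have hVaff : IsAffineOpen V := hW.basicOpen g
  haveI : IsAffine (V : Scheme.{0}) := hVaff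
  -- `Γ(V, ⊤)` as a `Γ(G, W)`-algebra: a localisation away from `g`
  have hle : V.ι ''ᵁ ⊤ ≤ W := by rw [Scheme.Opens.ι_image_top]; exact G.basicOpen_le g
  letI alg : Algebra Γ(G, W) Γ((V : Scheme.{0}), ⊤) := (G.presheaf.map (homOfLE hle).op).hom.toAlgebra
  haveI hlocV : IsLocalization.Away g Γ((V : Scheme.{0}), ⊤) := by
    haveI := hW.isLocalization_basicOpen g
    refine IsLocalization.isLocalization_of_algEquiv (Submonoid.powers g)
      (AlgEquiv.ofRingEquiv (f := V.topIso.symm.commRingCatIsoToRingEquiv) fun a => ?_)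
    have hcomp : G.presheaf.map (homOfLE (G.basicOpen_le g)).op ≫ V.topIso.inv = G.presheaf.map (homOfLE hle).op := by
      rw [Scheme.Opens.topIso_inv]
      exact ((G.presheaf.map_comp _ _).symm.trans (by rfl))
    exact congrArg (fun φ : Γ(G, W) ⟶ Γ((V : Scheme.{0}), ⊤) => φ.hom a) hcomp
  obtain ⟨hIL, hqr⟩ := hloc Γ((V : Scheme.{0}), ⊤)
  -- the ideal of `J|_V` on the affine scheme `V`
  have hJV : (J.comap V.ι).ideal ⟨⊤, isAffineOpen_top _⟩ =
      Ideal.span (Set.range (algebraMap Γ(G, W) Γ((V : Scheme.{0}), ⊤) ∘ f)) := by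
    rw [← hIL, Scheme.IdealSheafData.ideal_comap_of_isOpenImmersion, Scheme.Opens.ι_appIso, Iso.refl_inv, ← hI𝔭]
    have hWV : J.ideal ⟨V.ι ''ᵁ ⊤, (isAffineOpen_top (V : Scheme.{0})).image_of_isOpenImmersion V.ι⟩ =
        I.map (G.presheaf.map (homOfLE hle).op).hom :=
      (J.map_ideal (U := ⟨V.ι ''ᵁ ⊤, _⟩) (V := ⟨W, hW⟩) hle).symm
    rw [hWV]
    change (I.map _).comap (RingHom.id _) = _
    rw [Ideal.comap_id]
    rfl
  -- the blow-up restricted over `V` and the reduced point `B = V(J|_V) ↪ V` (`i₀ = (J.comap V.ι).subschemeι`)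
  have hβ : IsBlowup (υ ∣_ V) (J.comap V.ι).subschemeι.ker := by
    rw [Scheme.IdealSheafData.ker_subschemeι]; exact hυ.restrict V
  have hgen : Ideal.span (Set.range (algebraMap Γ(G, W) Γ((V : Scheme.{0}), ⊤) ∘ f)) =
      (J.comap V.ι).subschemeι.ker.ideal ⟨⊤, isAffineOpen_top _⟩ := by
    rw [Scheme.IdealSheafData.ker_subschemeι]; exact hJV.symm
  -- Hartshorne II 8.24 (b), affine form: the scheme-theoretic fibre is `ℙⁿ` over the reduced point
  obtain ⟨φ, -⟩ := exists_iso_pullback_proj_of_isQuasiRegular hβ _ hgen hqr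
  -- the base ring `R = Γ(B, 𝒪)` is a field: `Γ(V) ⧸ 𝔭·Γ(V) = Γ(W) ⧸ 𝔭`
  have hsurjB : Function.Surjective ((J.comap V.ι).subschemeι.app ⊤).hom := (J.comap V.ι).subschemeι.app_surjective ⊤ (isAffineOpen_top _)
  have hkerB : RingHom.ker ((J.comap V.ι).subschemeι.app ⊤).hom = 𝔭.asIdeal.map (algebraMap Γ(G, W) Γ((V : Scheme.{0}), ⊤)) := by
    rw [← Scheme.Hom.ker_apply (J.comap V.ι).subschemeι ⟨⊤, isAffineOpen_top _⟩, ← hgen, hIL]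
  have hfieldB : IsField (Γ((J.comap V.ι).subscheme, ⊤) : Type) := by
    have hq := isField_quotient_map_of_isMaximal_away 𝔭.asIdeal hgp Γ((V : Scheme.{0}), ⊤)
    letI := hq.toField
    exact MulEquiv.isField (Field.toIsField _)
      ((Ideal.quotEquivOfEq hkerB).symm.trans (RingHom.quotientKerEquivOfSurjective hsurjB)).symm.toMulEquiv
  -- the fibre is reduced (it is `ℙⁿ` over a field) and is a closed subscheme of `G'` with support `υ⁻¹{x}`
  haveI : IsDomain (Γ((J.comap V.ι).subscheme, ⊤) : Type) := hfieldB.isDomain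
  haveI : IsReduced (Proj (Literature.AlgebraicGeometry.Motives.Segre.grading (Fin (n + 1)) (Γ((J.comap V.ι).subscheme, ⊤) : Type))) :=
    Proj.isReduced _
  haveI : IsReduced (pullback (υ ∣_ V) (J.comap V.ι).subschemeι) := isReduced_of_isOpenImmersion φ.hom
  set c : pullback (υ ∣_ V) (J.comap V.ι).subschemeι ⟶ G' := pullback.fst (υ ∣_ V) (J.comap V.ι).subschemeι ≫ (υ ⁻¹ᵁ V).ι with hc
  have hrange : Set.range c = υ ⁻¹' {(y : G)} := by
    rw [hc, Scheme.Hom.comp_base, TopCat.coe_comp, Set.range_comp, Scheme.Pullback.range_fst,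
      Scheme.IdealSheafData.range_subschemeι, Scheme.IdealSheafData.support_comap, TopologicalSpace.Closeds.coe_preimage, hJ,
      Scheme.IdealSheafData.coe_support_vanishingIdeal]
    ext y'
    constructor
    · rintro ⟨z, hz, rfl⟩
      have hz' : (V.ι : _ ) ((υ ∣_ V) z) ∈ ({(y : G)} : Set G) := hz
      rw [← Scheme.Hom.comp_apply, morphismRestrict_ι, Scheme.Hom.comp_apply] at hz'
      exact hz'
    · intro hy'
      have hxV : υ y' ∈ V := by rw [show υ y' = (y : G) from hy']; exact hxg
      refine ⟨⟨y', hxV⟩, ?_, rfl⟩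
      change (V.ι : _) ((υ ∣_ V) ⟨y', hxV⟩) ∈ ({(y : G)} : Set G)
      rw [← Scheme.Hom.comp_apply, morphismRestrict_ι, Scheme.Hom.comp_apply]
      exact hy'
  haveI : IsClosedImmersion c := by
    refine IsClosedImmersion.of_isPreimmersion c ?_
    rw [hrange]; exact hx.preimage υ.continuous
  haveI : IsReduced (redSub G' (υ ⁻¹' {(y : G)}) (hx.preimage υ.continuous)) := isReduced_redSub G' _ _
  obtain ⟨e', -⟩ := Literature.AlgebraicGeometry.Motives.exists_iso_of_isClosedImmersion_of_range_eq
    (redSubι G' (υ ⁻¹' {(y : G)}) (hx.preimage υ.continuous)) c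
    (by rw [hrange, Scheme.IdealSheafData.range_subschemeι, Scheme.IdealSheafData.coe_support_vanishingIdeal]; rfl)
  exact ⟨Γ((J.comap V.ι).subscheme, ⊤), hfieldB, ⟨φ.symm ≪≫ e'⟩⟩


/-- **DOOR (ii) FOR THE NEST CLAUSE, END TO END.**  In the setting of `exists_iso_proj_redSub_preimage_singleton` (a point step at a closed point
`x` with `𝒪_{G,x}` regular of dimension `n + 1`), let `Z ⊆ υ⁻¹{x}` be closed.  If for EVERY field `R` and EVERY isomorphism
`e : ℙⁿ_R ≅ redSub G' (υ⁻¹{x})` the pulled-back curve `e⁻¹(Z)` is unobstructed in the host `univ` of `ℙⁿ_R` (a MODEL statement — e.g. a theorem about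
all curves of a given kind in `ℙ²_R`), then the NEST clause `DirStepUnobs G' (υ⁻¹{x}) _ Z hZ` holds.  (= the plane iso + the model door (H2)
✓ `dirStepUnobs_of_model_iso`.) [OURS · L1 W4.5b · EL♮(3) · NEST host kit; NOT a statement of the manuscript] -/
theorem dirStepUnobs_freshPlane_of_forall_model {G G' : Scheme.{0}} [IsLocallyNoetherian G]
    {x : G} (hx : IsClosed ({x} : Set G)) (hreg : IsRegularLocalRing (G.presheaf.stalk x))
    {n : ℕ} (hdim : ringKrullDim (G.presheaf.stalk x) = (n + 1 : ℕ))
    {υ : G' ⟶ G} (hυ : IsBlowup υ (vanishingIdeal ⟨{x}, hx⟩))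
    (Z : Set G') (hZ : IsClosed Z) (hZE : Z ⊆ υ ⁻¹' {x})
    (hmodel : ∀ (R : CommRingCat.{0}) (_ : IsField R),
      letI := MvPolynomial.gradedAlgebra (σ := Fin (n + 1)) (R := (R : Type));
      ∀ (e : Proj (Literature.AlgebraicGeometry.Motives.Segre.grading (Fin (n + 1)) R) ≅ redSub G' (υ ⁻¹' {x}) (hx.preimage υ.continuous)),
      DirStepUnobs (Proj (Literature.AlgebraicGeometry.Motives.Segre.grading (Fin (n + 1)) R)) Set.univ isClosed_univ
        (e.hom ⁻¹' ((redSubι G' (υ ⁻¹' {x}) (hx.preimage υ.continuous)) ⁻¹' Z))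
        ((hZ.preimage (redSubι G' (υ ⁻¹' {x}) (hx.preimage υ.continuous)).continuous).preimage e.hom.continuous)) :
    DirStepUnobs G' (υ ⁻¹' {x}) (hx.preimage υ.continuous) Z hZ := by
  letI gradedInst : ∀ (S : Type) [CommRing S], GradedAlgebra (Literature.AlgebraicGeometry.Motives.Segre.grading (Fin (n + 1)) S) :=
    fun S _ => MvPolynomial.gradedAlgebra
  obtain ⟨R, hR, ⟨e⟩⟩ := exists_iso_proj_redSub_preimage_singleton hx hreg hdim hυ
  refine dirStepUnobs_of_model_iso _ _ _ (hmodel R hR e) G' (υ ⁻¹' {x}) (hx.preimage υ.continuous) Z hZ hZE e ?_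
  -- `e` is surjective, so `e(e⁻¹ S) = S`
  exact Set.image_preimage_eq _ (fun z => ⟨e.inv z, by rw [← Scheme.Hom.comp_apply, Iso.inv_hom_id]; rfl⟩)

end Summit.ResolutionOfSingularities.ResolutionOfSingularities.Cruxes.EquisingularLiftNat.Sections

end
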